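import Summits.QuantumFields.QCD.Theorems.SpectralDefectExtinctionWegnerEstimateStubCoareaWegner
import Summits.QuantumFields.QCD.Theorems.SpectralDefectExtinctionWegnerEstimateCoareaCoreHolder

/-!
# The HÖLDER BRANCH of stub `coareaWegner` of line `Sketch` (skeleton "ResolventCell", gen 2c) for crux
`SpectralDefectExtinction.WegnerEstimate` (item stmt-QuantumFields-8966) — THE 1-D ROUTE WITHOUT THE TUBE SUM

The planners' declared repair target if the linear estimate resists (`wegnerEstimate_imp_holder`,
`Theorems/WegnerEstimate/Negative/LoadBearing.lean`: an `ε^α` Wegner bound, any `α < 1`, still serves the route).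
The landed 1-D route (`stub_coareaWegner`, p145270) needs the small-ball exponent `m` of the saturated bad set to
EXCEED the rigidity exponent `k` (tube sum).  This file runs the same route through the Hölder core
`coareaWegner_coreBoundHolder` (threshold split at `δ₀`, uniform bound `t_x ≤ 12/ε` on the bad set), which needs only
`0 < m`, and optimises `δ₀ = ε^{1/(m+k)}`:

* `coareaWegnerHolder_exponents` — the `Real.rpow` bookkeeping of the threshold;
* `coareaWegnerHolder_lintegral_le` — the Hölder core instantiated on the Wilson cell (verbatim directions, circles and
  currents of `coareaWegner_lintegral_le_const`);
* `stub_coareaWegnerHolder` — the local Haar–Wegner lemma in Hölder form `E_V t_x ≤ C ε^{-θ}`, `θ = k/(m+k) < 1`, from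
  `stub_circleZeroCount`, `stub_resolventLocalSpectralSum` (verbatim hypotheses) and the WEAK rigidity data.
-/

noncomputable section

namespace Summit.QuantumFields.QCD.Cruxes.WegnerEstimate.ResolventCell

open MeasureTheory Filter
open scoped Matrix BigOperators ENNReal NNReal Topology
open Literature.MathematicalPhysics.QuantumLattice Literature.MathematicalPhysics.QuantumFieldTheory
  Literature.Probability.LatticeModels
open Literature.Barriers.QuantumFields (isHermitian_gammaFive_mul_wilsonDirac)
open Matrix
open scoped ComplexOrder

/-! ### The threshold exponents -/

/-- **`Real.rpow` bookkeeping of the threshold `δ₀ = ε^{1/(m+k)}`**: `δ₀ ∈ (0,1]`, `δ₀^{-k} = ε^{-k/(m+k)}`,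
`(12/ε) δ₀^m = 12 ε^{-k/(m+k)}` and `ε^{-k/(m+k)} ≥ 1` for `ε ∈ (0,1]`. -/
theorem coareaWegnerHolder_exponents {m : ℝ} {k : ℕ} (hm : 0 < m) {ε : ℝ} (hε : 0 < ε) (hε1 : ε ≤ 1) :
    0 < ε ^ (1 / (m + k)) ∧ ε ^ (1 / (m + k)) ≤ 1 ∧
    ((ε ^ (1 / (m + k))) ^ k)⁻¹ = ε ^ (-(k / (m + k))) ∧
    12 / ε * (ε ^ (1 / (m + k))) ^ m = 12 * ε ^ (-(k / (m + k))) ∧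
    1 ≤ ε ^ (-(k / (m + k))) := by
  have hmk : 0 < m + k := by positivity
  refine ⟨Real.rpow_pos_of_pos hε _, Real.rpow_le_one hε.le hε1 (by positivity), ?_, ?_,
    Real.one_le_rpow_of_pos_of_le_one_of_nonpos hε hε1 (neg_nonpos.2 (by positivity))⟩
  · rw [← Real.rpow_natCast, ← Real.rpow_mul hε.le, ← Real.rpow_neg hε.le]
    congr 1
    ring
  · rw [← Real.rpow_mul hε.le]
    have h : 1 / (m + k) * m - 1 = -(k / (m + k)) := by
      field_simp
      ring
    rw [← h, Real.rpow_sub_one hε.ne']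
    ring

/-! ### The Hölder core on the Wilson cell -/

set_option maxHeartbeats 1600000 in
/-- **The lintegral form of the local Haar–Wegner bound, Hölder branch** on one torus, for one site,
exterior, mass, `ε` and threshold `δ₀ ∈ (0,1]`, from the WEAK rigidity data (`0 < m` only): the abstract
Hölder core `coareaWegner_coreBoundHolder` instantiated on the Wilson cell with `T = 12/ε`. -/
theorem coareaWegnerHolder_lintegral_le
    (hzero : ∀ (N r : ℕ) (A : Matrix (Fin N) (Fin N) ℂ) (B : Matrix (Fin N) (Fin r) ℂ) (C : Matrix (Fin r) (Fin N) ℂ)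
      (δ₀ δ₁ δ₂ : Matrix (Fin r) (Fin r) ℂ),
      (∀ t : ℝ, (A + B * (δ₀ + ((Real.cos t : ℝ) : ℂ) • δ₁ + ((Real.sin t : ℝ) : ℂ) • δ₂) * C).det = 0) ∨
      ({t : ℝ | t ∈ Set.Ico (0 : ℝ) (2 * Real.pi) ∧
          (A + B * (δ₀ + ((Real.cos t : ℝ) : ℂ) • δ₁ + ((Real.sin t : ℝ) : ℂ) • δ₂) * C).det = 0}.Finite ∧
        {t : ℝ | t ∈ Set.Ico (0 : ℝ) (2 * Real.pi) ∧
          (A + B * (δ₀ + ((Real.cos t : ℝ) : ℂ) • δ₁ + ((Real.sin t : ℝ) : ℂ) • δ₂) * C).det = 0}.ncard ≤ 2 * r))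
    (hspec : ∀ (n : Type) [Fintype n] [DecidableEq n] (A : Matrix n n ℂ) (hA : A.IsHermitian) (P : Finset n) (ε : ℝ),
      0 < ε →
      ∑ p ∈ P, ((A - ((ε : ℂ) * Complex.I) • (1 : Matrix n n ℂ))⁻¹ p p).im =
        ∑ j : n, (∑ p ∈ P, ‖(hA.eigenvectorBasis j) p‖ ^ 2) * (ε / (hA.eigenvalues j ^ 2 + ε ^ 2)))
    {R R' k : ℕ} {m c₀ C_B : ℝ} (hm : 0 < m) (hc₀ : 0 < c₀)
    (bad : ((Fin 4 → ℤ) × Fin 4 → SU3) → ℝ) (hbad_cont : Continuous bad)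
    (hsmall : ∀ (L : ℕ) [NeZero L], 2 ≤ L → ∀ (x : TorusSite 4 L) (U : GaugeConfig 4 L SU3) (e₀ : Edge 4 L) (δ : ℝ),
      0 < δ → δ ≤ 1 →
      (Measure.pi fun _ : Edge 4 L => haarProbability SU3)
          {V : GaugeConfig 4 L SU3 | ∃ g : SU3,
            bad (fun l => (fun e : Edge 4 L => if (∃ y ∈ box 4 R, e.1 = x + Torus.proj L y) then
                Function.update V e₀ g e else U e) (x + Torus.proj L l.1, l.2)) < δ} ≤
        ENNReal.ofReal (C_B * δ ^ m))
    (hrig2 : ∀ (L : ℕ) [NeZero L], 2 ≤ L → ∀ (x : TorusSite 4 L) (m₀ : ℝ), -1 ≤ m₀ → m₀ ≤ 0 →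
      ∀ (U V : GaugeConfig 4 L SU3) (ψ : QuarkIdx L → ℂ) (lam : ℝ), |lam| ≤ 1 →
      (spinorLift gammaFive * wilsonDirac (fundamentalRep (Fin 3))
          (fun e => if (∃ y ∈ box 4 R, e.1 = x + Torus.proj L y) then V e else U e) m₀ 1).mulVec ψ =
        (lam : ℂ) • ψ →
      c₀ * bad (fun l => (fun e : Edge 4 L => if (∃ y ∈ box 4 R, e.1 = x + Torus.proj L y) then V e else U e)
              (x + Torus.proj L l.1, l.2)) ^ k *
          boxMass ψ ((box 4 R').image fun y => x + Torus.proj L y) ≤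
        ∑ y ∈ box 4 R, ∑ μ : Fin 4, ∑ i : Fin 8,
          |2 * (∑ a : Fin 3, ∑ b : Fin 3, ∑ α : Fin 4, ∑ β : Fin 4,
              star (ψ (x + Torus.proj L y, a, α)) *
                (gammaFive * ((-(1 / 2 : ℂ)) • ((1 : Matrix (Fin 4) (Fin 4) ℂ) - euclideanGamma μ))) α β *
                ((((fun e : Edge 4 L => if (∃ y ∈ box 4 R, e.1 = x + Torus.proj L y) then V e else U e) (x + Torus.proj L y, μ) : SU3) : Matrix (Fin 3) (Fin 3) ℂ) *
                    (![!![0, 1, 0; -1, 0, 0; 0, 0, 0], !![0, 0, 1; 0, 0, 0; -1, 0, 0],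
                   !![0, 0, 0; 0, 0, 1; 0, -1, 0], !![0, Complex.I, 0; Complex.I, 0, 0; 0, 0, 0],
                   !![0, 0, Complex.I; 0, 0, 0; Complex.I, 0, 0],
                   !![0, 0, 0; 0, 0, Complex.I; 0, Complex.I, 0],
                   !![Complex.I, 0, 0; 0, -Complex.I, 0; 0, 0, 0],
                   !![0, 0, 0; 0, Complex.I, 0; 0, 0, -Complex.I]] i : Matrix (Fin 3) (Fin 3) ℂ)) a b *
                ψ (Literature.MathematicalPhysics.QuantumFieldTheory.Site.shift (x + Torus.proj L y) μ,
                  b, β)).re|)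
    {L : ℕ} [NeZero L] (hL : 2 ≤ L) (x : TorusSite 4 L) {m₀ ε : ℝ} (hm₀ : -1 ≤ m₀) (hm₀' : m₀ ≤ 0)
    (hε : 0 < ε) (hε1 : ε ≤ 1) (U : GaugeConfig 4 L SU3)
    (δ₀ : ℝ) (hδ₀ : 0 < δ₀) (hδ₀1 : δ₀ ≤ 1) :
    ∫⁻ V, ENNReal.ofReal (∑ a : Fin 3, ∑ α : Fin 4,
        (((spinorLift gammaFive * wilsonDirac (fundamentalRep (Fin 3))
            (fun e => if (∃ y ∈ box 4 R, e.1 = x + Torus.proj L y) then V e else U e) m₀ 1 -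
          ((ε : ℂ) * Complex.I) • (1 : Matrix (QuarkIdx L) (QuarkIdx L) ℂ))⁻¹ :
            Matrix (QuarkIdx L) (QuarkIdx L) ℂ) (x, a, α) (x, a, α)).im)
        ∂(Measure.pi fun _ : Edge 4 L => haarProbability SU3) ≤
      ENNReal.ofReal 12 + ENNReal.ofReal c₀⁻¹ * (Fintype.card ((↥(box 4 R) × Fin 4) × Fin 8) *
        (ENNReal.ofReal (2 * Real.pi)⁻¹ * ENNReal.ofReal (4656 * Real.pi) * ENNReal.ofReal (δ₀ ^ k)⁻¹)) +
      ENNReal.ofReal (12 / ε) * (Fintype.card ((↥(box 4 R) × Fin 4) × Fin 8) * ENNReal.ofReal (C_B * δ₀ ^ m)) := by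
  -- the eight basis circles
  choose circ hcirc using fun i : Fin 8 => coareaWegner_su3Circles i
  -- continuity of the glue and of the Hermitian Wilson operator
  have hglue : Continuous fun V : GaugeConfig 4 L SU3 =>
      ((fun e : Edge 4 L => if (∃ y ∈ box 4 R, e.1 = x + Torus.proj L y) then V e else U e) :
        GaugeConfig 4 L SU3) := by
    have h := (cellAverage_continuous_glue (L := L)
      (fun e : Edge 4 L => ∃ y ∈ box 4 R, e.1 = x + Torus.proj L y)).comp (Continuous.prodMk_right U)
    exact h
  have hHW : Continuous fun W : GaugeConfig 4 L SU3 =>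
      spinorLift gammaFive * wilsonDirac (fundamentalRep (Fin 3)) W m₀ 1 :=
    continuous_const.mul (continuous_wilsonDirac (fundamentalRep (Fin 3)) (continuous_fundamentalRep (Fin 3)) m₀ 1)
  have hHof : Continuous fun V : GaugeConfig 4 L SU3 => spinorLift gammaFive * wilsonDirac (fundamentalRep (Fin 3))
      (fun e : Edge 4 L => if (∃ y ∈ box 4 R, e.1 = x + Torus.proj L y) then V e else U e) m₀ 1 := by
    have h := hHW.comp hglue
    exact h
  have herm : ∀ W : GaugeConfig 4 L SU3,
      (spinorLift gammaFive * wilsonDirac (fundamentalRep (Fin 3)) W m₀ 1).IsHermitian := fun W =>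
    isHermitian_gammaFive_mul_wilsonDirac (fundamentalRep (Fin 3)) fundamentalRep_mem_unitaryGroup W m₀ 1
  -- cell links
  have hcell : ∀ d : (↥(box 4 R) × Fin 4) × Fin 8,
      ∃ y ∈ box 4 R, ((x + Torus.proj L d.1.1, d.1.2) : Edge 4 L).1 = x + Torus.proj L y :=
    fun d => ⟨d.1.1, d.1.1.2, rfl⟩
  refine coareaWegner_coreHolder_lintegral_le (G := SU3) (ι := Edge 4 L) (n := QuarkIdx L)
    (fun V : GaugeConfig 4 L SU3 => spinorLift gammaFive * wilsonDirac (fundamentalRep (Fin 3))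
      (fun e : Edge 4 L => if (∃ y ∈ box 4 R, e.1 = x + Torus.proj L y) then V e else U e) m₀ 1)
    hHof
    (fun V : GaugeConfig 4 L SU3 =>
      herm (fun e : Edge 4 L => if (∃ y ∈ box 4 R, e.1 = x + Torus.proj L y) then V e else U e))
    (fun V : GaugeConfig 4 L SU3 =>
      ∑ a : Fin 3, ∑ α : Fin 4,
        (((spinorLift gammaFive * wilsonDirac (fundamentalRep (Fin 3))
            (fun e => if (∃ y ∈ box 4 R, e.1 = x + Torus.proj L y) then V e else U e) m₀ 1 -
          ((ε : ℂ) * Complex.I) • (1 : Matrix (QuarkIdx L) (QuarkIdx L) ℂ))⁻¹ :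
            Matrix (QuarkIdx L) (QuarkIdx L) ℂ) (x, a, α) (x, a, α)).im)
    (fun V : GaugeConfig 4 L SU3 => bad (fun l => (fun e : Edge 4 L =>
      if (∃ y ∈ box 4 R, e.1 = x + Torus.proj L y) then V e else U e) (x + Torus.proj L l.1, l.2)))
    ?_ (fun E => ε / (E ^ 2 + ε ^ 2)) ?_ (fun E => by positivity)
    (A₀ := 12) (by norm_num) hc₀ hm (12 / ε) ?_ δ₀ hδ₀ hδ₀1 ((x, 0) : Edge 4 L) ?_
    (Dir := (↥(box 4 R) × Fin 4) × Fin 8)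
    (fun d => ((x + Torus.proj L d.1.1, d.1.2) : Edge 4 L)) (fun d => circ d.2)
    (fun d => (hcirc d.2).2.1) (fun d => (hcirc d.2).2.2.1) (fun d => (hcirc d.2).2.2.2.2.1)
    (fun d V ψ => 2 * (∑ a : Fin 3, ∑ b : Fin 3, ∑ α : Fin 4, ∑ β : Fin 4,
              star (ψ (x + Torus.proj L d.1.1, a, α)) *
                (gammaFive * ((-(1 / 2 : ℂ)) • ((1 : Matrix (Fin 4) (Fin 4) ℂ) - euclideanGamma d.1.2))) α β *
                ((((fun e : Edge 4 L => if (∃ y ∈ box 4 R, e.1 = x + Torus.proj L y) then V e else U e)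
                      (x + Torus.proj L d.1.1, d.1.2) : SU3) : Matrix (Fin 3) (Fin 3) ℂ) *
                    (![!![0, 1, 0; -1, 0, 0; 0, 0, 0], !![0, 0, 1; 0, 0, 0; -1, 0, 0],
                   !![0, 0, 0; 0, 0, 1; 0, -1, 0], !![0, Complex.I, 0; Complex.I, 0, 0; 0, 0, 0],
                   !![0, 0, Complex.I; 0, 0, 0; Complex.I, 0, 0],
                   !![0, 0, 0; 0, 0, Complex.I; 0, Complex.I, 0],
                   !![Complex.I, 0, 0; 0, -Complex.I, 0; 0, 0, 0],
                   !![0, 0, 0; 0, Complex.I, 0; 0, 0, -Complex.I]] d.2 : Matrix (Fin 3) (Fin 3) ℂ)) a b *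
                ψ (Literature.MathematicalPhysics.QuantumFieldTheory.Site.shift (x + Torus.proj L d.1.1) d.1.2,
                  b, β)).re)
    ?_ ?_ ?_ (B := ENNReal.ofReal (4656 * Real.pi)) ?_ ?_
  · -- continuity of the badness of the glued cell
    refine hbad_cont.comp (continuous_pi fun l => ?_)
    exact (continuous_apply (x + Torus.proj L l.1, l.2)).comp hglue
  · -- continuity of the window
    exact continuous_const.div (by fun_prop) fun E => by positivity
  · -- the uniform bound `t_x ≤ 12/ε` (`stub_localTraceRegular`)
    intro V
    exact ((stub_localTraceRegular L x m₀ ε hε).2 _).2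
  · -- small saturated tubes
    intro e' δ hδ hδ1
    exact hsmall L hL x U e' δ hδ hδ1
  · -- the current is the `s`-derivative of the quadratic form (transport of bridge A)
    intro d V ψ
    beta_reduce
    have T := coareaWegner_glued_hellmannFeynman R x U V m₀ (d.1.1 : Fin 4 → ℤ) d.1.1.2 d.1.2
      (![!![0, 1, 0; -1, 0, 0; 0, 0, 0], !![0, 0, 1; 0, 0, 0; -1, 0, 0],
                   !![0, 0, 0; 0, 0, 1; 0, -1, 0], !![0, Complex.I, 0; Complex.I, 0, 0; 0, 0, 0],
                   !![0, 0, Complex.I; 0, 0, 0; Complex.I, 0, 0],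
                   !![0, 0, 0; 0, 0, Complex.I; 0, Complex.I, 0],
                   !![Complex.I, 0, 0; 0, -Complex.I, 0; 0, 0, 0],
                   !![0, 0, 0; 0, Complex.I, 0; 0, 0, -Complex.I]] d.2 : Matrix (Fin 3) (Fin 3) ℂ)
      (circ d.2) (hcirc d.2).2.2.2.2.2 ψ
    exact T
  · -- Lipschitz sorted eigenvalues along circles (transport of bridge H)
    intro d V
    obtain ⟨δ₀, δ₁, δ₂, hcshape⟩ := (hcirc d.2).1
    have T := coareaWegner_glued_eigenvalues₀_lipschitz R x U V m₀ (x + Torus.proj L d.1.1, d.1.2) (hcell d)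
      (circ d.2) δ₀ δ₁ δ₂ hcshape herm
    exact T
  · -- entrywise differentiability of the circle family (transport of bridge H′)
    intro d V
    obtain ⟨δ₀, δ₁, δ₂, hcshape⟩ := (hcirc d.2).1
    have T := coareaWegner_glued_hasDerivAt_entry R x U V m₀ (x + Torus.proj L d.1.1, d.1.2) (hcell d)
      (circ d.2) δ₀ δ₁ δ₂ hcshape
    exact T
  · -- the area bound along each circle (transport of bridge M)
    intro d V
    obtain ⟨δ₀, δ₁, δ₂, hcshape⟩ := (hcirc d.2).1
    have T := coareaWegner_glued_areaBound hzero R x U V m₀ (x + Torus.proj L d.1.1, d.1.2) (hcell d)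
      (circ d.2) δ₀ δ₁ δ₂ hcshape (hcirc d.2).2.2.2.1 herm hε
    exact T
  · -- the pointwise tail/weight/rigidity bound (bridge G), directions reindexed
    intro V hbV
    beta_reduce at hbV ⊢
    have hG := coareaWegner_localTrace_pointwise hspec x
      (fun e : Edge 4 L => if (∃ y ∈ box 4 R, e.1 = x + Torus.proj L y) then V e else U e) m₀ hε hε1 hc₀ hbV
      (herm _) (fun ψ lam hlam hψ => hrig2 L hL x m₀ hm₀ hm₀' U V ψ lam hlam hψ)
    rw [coareaWegner_sum_box_dir (box 4 R)] at hG
    exact hG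

/-! ### The Hölder stub -/

set_option maxHeartbeats 400000 in
/-- **Stub `coareaWegnerHolder` (the HÖLDER BRANCH of the 1-D route).**  IF (a) one-link circles meet level sets at
most `2r` times (`stub_circleZeroCount`, verbatim), (b) the site-local resolvent trace is the mass-weighted spectral sum
(`stub_resolventLocalSpectralSum`, verbatim), and (c′) near-zero modes obey current/mass rigidity with a
small-saturated-tube exceptional set whose small-ball exponent is only POSITIVE (`hrigWeak`: the verbatim
`stub_currentRigidity` with `k < m` weakened to `0 < m`), THEN the local Haar–Wegner lemma with frozen genuine exterior
holds in HÖLDER form: `E_V t_x ≤ C ε^{-θ}` with `θ = k/(m+k) < 1`, uniformly in `L ≥ 2`, `x`, the exterior,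
`m₀ ∈ [−1,0]`, `ε ∈ (0,1]` (hypothesis of `wegnerEstimateHolder_of_localHaarWegnerHolder`, which turns it into the
`ε^{1−θ}` Wegner estimate `wegnerEstimate_imp_holder` declares sufficient for the route).  Proof: the Hölder core
`coareaWegner_coreBoundHolder` on the Wilson cell (`coareaWegnerHolder_lintegral_le`) with `T = 12/ε`
(`stub_localTraceRegular`) and the threshold `δ₀ = ε^{1/(m+k)}`, for which `δ₀^{-k} = ε^{-θ}` and
`T δ₀^m = 12 ε^{-θ}`; constants `C = 12 + c₀⁻¹ · #directions · 2328 + 12 · #directions · C_B`,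
`#directions = 32 · #(box 4 R)`.  Sources as for `stub_coareaWegner` (Erdős–Hasler, AHP 13 (2012) 1719, §3; Kato II
§6; Federer 3.2.3). -/
theorem stub_coareaWegnerHolder
    (hzero : ∀ (N r : ℕ) (A : Matrix (Fin N) (Fin N) ℂ) (B : Matrix (Fin N) (Fin r) ℂ) (C : Matrix (Fin r) (Fin N) ℂ)
      (δ₀ δ₁ δ₂ : Matrix (Fin r) (Fin r) ℂ),
      (∀ t : ℝ, (A + B * (δ₀ + ((Real.cos t : ℝ) : ℂ) • δ₁ + ((Real.sin t : ℝ) : ℂ) • δ₂) * C).det = 0) ∨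
      ({t : ℝ | t ∈ Set.Ico (0 : ℝ) (2 * Real.pi) ∧
          (A + B * (δ₀ + ((Real.cos t : ℝ) : ℂ) • δ₁ + ((Real.sin t : ℝ) : ℂ) • δ₂) * C).det = 0}.Finite ∧
        {t : ℝ | t ∈ Set.Ico (0 : ℝ) (2 * Real.pi) ∧
          (A + B * (δ₀ + ((Real.cos t : ℝ) : ℂ) • δ₁ + ((Real.sin t : ℝ) : ℂ) • δ₂) * C).det = 0}.ncard ≤ 2 * r))
    (hspec : ∀ (n : Type) [Fintype n] [DecidableEq n] (A : Matrix n n ℂ) (hA : A.IsHermitian) (P : Finset n) (ε : ℝ),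
      0 < ε →
      ∑ p ∈ P, ((A - ((ε : ℂ) * Complex.I) • (1 : Matrix n n ℂ))⁻¹ p p).im =
        ∑ j : n, (∑ p ∈ P, ‖(hA.eigenvectorBasis j) p‖ ^ 2) * (ε / (hA.eigenvalues j ^ 2 + ε ^ 2)))
    (hrigWeak : ∃ (R R' k : ℕ) (m c₀ C_B : ℝ), R' ≤ R ∧ 0 < m ∧ 0 < c₀ ∧ 0 < C_B ∧
      ∃ bad : ((Fin 4 → ℤ) × Fin 4 → SU3) → ℝ, Continuous bad ∧ (∀ w, 0 ≤ bad w) ∧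
        (∀ (L : ℕ) [NeZero L], 2 ≤ L → ∀ (x : TorusSite 4 L) (U : GaugeConfig 4 L SU3) (e₀ : Edge 4 L) (δ : ℝ),
          0 < δ → δ ≤ 1 →
          (Measure.pi fun _ : Edge 4 L => haarProbability SU3)
              {V : GaugeConfig 4 L SU3 | ∃ g : SU3,
                bad (fun l => (fun e : Edge 4 L => if (∃ y ∈ box 4 R, e.1 = x + Torus.proj L y) then
                    Function.update V e₀ g e else U e) (x + Torus.proj L l.1, l.2)) < δ} ≤
            ENNReal.ofReal (C_B * δ ^ m)) ∧
        ∀ (L : ℕ) [NeZero L], 2 ≤ L → ∀ (x : TorusSite 4 L) (m₀ : ℝ), -1 ≤ m₀ → m₀ ≤ 0 →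
          ∀ (U V : GaugeConfig 4 L SU3) (ψ : QuarkIdx L → ℂ) (lam : ℝ), |lam| ≤ 1 →
          (spinorLift gammaFive * wilsonDirac (fundamentalRep (Fin 3))
              (fun e => if (∃ y ∈ box 4 R, e.1 = x + Torus.proj L y) then V e else U e) m₀ 1).mulVec ψ =
            (lam : ℂ) • ψ →
          c₀ * bad (fun l => (fun e : Edge 4 L => if (∃ y ∈ box 4 R, e.1 = x + Torus.proj L y) then V e else U e)
                  (x + Torus.proj L l.1, l.2)) ^ k *
              boxMass ψ ((box 4 R').image fun y => x + Torus.proj L y) ≤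
            ∑ y ∈ box 4 R, ∑ μ : Fin 4, ∑ i : Fin 8,
              |2 * (∑ a : Fin 3, ∑ b : Fin 3, ∑ α : Fin 4, ∑ β : Fin 4,
                  star (ψ (x + Torus.proj L y, a, α)) *
                    (gammaFive * ((-(1 / 2 : ℂ)) • ((1 : Matrix (Fin 4) (Fin 4) ℂ) - euclideanGamma μ))) α β *
                    ((((fun e : Edge 4 L => if (∃ y ∈ box 4 R, e.1 = x + Torus.proj L y) then V e else U e)
                          (x + Torus.proj L y, μ) : SU3) : Matrix (Fin 3) (Fin 3) ℂ) *
                        (![!![0, 1, 0; -1, 0, 0; 0, 0, 0], !![0, 0, 1; 0, 0, 0; -1, 0, 0],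
                           !![0, 0, 0; 0, 0, 1; 0, -1, 0], !![0, Complex.I, 0; Complex.I, 0, 0; 0, 0, 0],
                           !![0, 0, Complex.I; 0, 0, 0; Complex.I, 0, 0],
                           !![0, 0, 0; 0, 0, Complex.I; 0, Complex.I, 0],
                           !![Complex.I, 0, 0; 0, -Complex.I, 0; 0, 0, 0],
                           !![0, 0, 0; 0, Complex.I, 0; 0, 0, -Complex.I]] i : Matrix (Fin 3) (Fin 3) ℂ)) a b *
                    ψ (Literature.MathematicalPhysics.QuantumFieldTheory.Site.shift (x + Torus.proj L y) μ,
                      b, β)).re|) :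
    ∃ R : ℕ, ∃ C θ : ℝ, 0 < C ∧ 0 ≤ θ ∧ θ < 1 ∧ ∀ (L : ℕ) [NeZero L], 2 ≤ L →
      ∀ (x : TorusSite 4 L) (m₀ ε : ℝ), -1 ≤ m₀ → m₀ ≤ 0 → 0 < ε → ε ≤ 1 →
      ∀ U : GaugeConfig 4 L SU3,
        ∫ V, (∑ a : Fin 3, ∑ α : Fin 4,
          (((spinorLift gammaFive * wilsonDirac (fundamentalRep (Fin 3))
              (fun e => if (∃ y ∈ box 4 R, e.1 = x + Torus.proj L y) then V e else U e) m₀ 1 -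
            ((ε : ℂ) * Complex.I) • (1 : Matrix (QuarkIdx L) (QuarkIdx L) ℂ))⁻¹ :
              Matrix (QuarkIdx L) (QuarkIdx L) ℂ) (x, a, α) (x, a, α)).im)
          ∂(Measure.pi fun _ : Edge 4 L => haarProbability SU3) ≤ C * ε ^ (-θ) := by
  obtain ⟨R, R', k, m, c₀, C_B, -, hm, hc₀, hCB, bad, hbad_cont, -, hsmall, hrig2⟩ := hrigWeak
  have hmk : 0 < m + k := by positivity
  refine ⟨R, 12 + c₀⁻¹ * (Fintype.card ((↥(box 4 R) × Fin 4) × Fin 8) * 2328) +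
      12 * (Fintype.card ((↥(box 4 R) × Fin 4) × Fin 8) * C_B), k / (m + k), by positivity, by positivity, ?_, ?_⟩
  · rw [div_lt_one hmk]
    linarith
  intro L _ hL x m₀ ε hm₀ hm₀' hε hε1 U
  obtain ⟨hδ₀, hδ₀1, hinvk, hTm, hone⟩ := coareaWegnerHolder_exponents (k := k) hm hε hε1
  have hlin := coareaWegnerHolder_lintegral_le hzero hspec hm hc₀ bad hbad_cont hsmall hrig2 hL x hm₀ hm₀' hε hε1 U
    (ε ^ (1 / (m + k))) hδ₀ hδ₀1
  -- evaluate the constant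
  have h1 : ENNReal.ofReal (2 * Real.pi)⁻¹ * ENNReal.ofReal (4656 * Real.pi) = ENNReal.ofReal 2328 := by
    rw [← ENNReal.ofReal_mul (inv_nonneg.2 Real.two_pi_pos.le)]
    congr 1
    field_simp
    ring
  have h2 : ENNReal.ofReal c₀⁻¹ * ((Fintype.card ((↥(box 4 R) × Fin 4) × Fin 8) : ENNReal) *
      (ENNReal.ofReal (2 * Real.pi)⁻¹ * ENNReal.ofReal (4656 * Real.pi) *
        ENNReal.ofReal ((ε ^ (1 / (m + k))) ^ k)⁻¹)) =
      ENNReal.ofReal (c₀⁻¹ * (Fintype.card ((↥(box 4 R) × Fin 4) × Fin 8) * 2328) * ε ^ (-(k / (m + k)))) := by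
    rw [h1, hinvk, ← ENNReal.ofReal_mul (by norm_num), ← ENNReal.ofReal_natCast,
      ← ENNReal.ofReal_mul (Nat.cast_nonneg _), ← ENNReal.ofReal_mul (inv_nonneg.2 hc₀.le)]
    congr 1
    ring
  have h3 : ENNReal.ofReal (12 / ε) * ((Fintype.card ((↥(box 4 R) × Fin 4) × Fin 8) : ENNReal) *
      ENNReal.ofReal (C_B * (ε ^ (1 / (m + k))) ^ m)) =
      ENNReal.ofReal (12 * (Fintype.card ((↥(box 4 R) × Fin 4) × Fin 8) * C_B) * ε ^ (-(k / (m + k)))) := by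
    rw [← ENNReal.ofReal_natCast, ← ENNReal.ofReal_mul (Nat.cast_nonneg _),
      ← ENNReal.ofReal_mul (div_nonneg (by norm_num) hε.le)]
    congr 1
    calc 12 / ε * ((Fintype.card ((↥(box 4 R) × Fin 4) × Fin 8) : ℝ) * (C_B * (ε ^ (1 / (m + k))) ^ m))
        = (Fintype.card ((↥(box 4 R) × Fin 4) × Fin 8) : ℝ) * C_B * (12 / ε * (ε ^ (1 / (m + k))) ^ m) := by
          ring
      _ = _ := by
          rw [hTm]
          ring
  have h4 : ENNReal.ofReal 12 ≤ ENNReal.ofReal (12 * ε ^ (-(k / (m + k)))) :=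
    ENNReal.ofReal_le_ofReal (le_mul_of_one_le_right (by norm_num) hone)
  have hX : 0 ≤ ε ^ (-(k / (m + k))) := Real.rpow_nonneg hε.le _
  have hbound : ENNReal.ofReal 12 + ENNReal.ofReal c₀⁻¹ * (Fintype.card ((↥(box 4 R) × Fin 4) × Fin 8) *
        (ENNReal.ofReal (2 * Real.pi)⁻¹ * ENNReal.ofReal (4656 * Real.pi) *
          ENNReal.ofReal ((ε ^ (1 / (m + k))) ^ k)⁻¹)) +
      ENNReal.ofReal (12 / ε) * (Fintype.card ((↥(box 4 R) × Fin 4) × Fin 8) *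
        ENNReal.ofReal (C_B * (ε ^ (1 / (m + k))) ^ m)) ≤
      ENNReal.ofReal ((12 + c₀⁻¹ * (Fintype.card ((↥(box 4 R) × Fin 4) × Fin 8) * 2328) +
        12 * (Fintype.card ((↥(box 4 R) × Fin 4) × Fin 8) * C_B)) * ε ^ (-(k / (m + k)))) := by
    rw [h2, h3]
    calc ENNReal.ofReal 12 +
          ENNReal.ofReal (c₀⁻¹ * (Fintype.card ((↥(box 4 R) × Fin 4) × Fin 8) * 2328) * ε ^ (-(k / (m + k)))) +
          ENNReal.ofReal (12 * (Fintype.card ((↥(box 4 R) × Fin 4) × Fin 8) * C_B) * ε ^ (-(k / (m + k))))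
        ≤ ENNReal.ofReal (12 * ε ^ (-(k / (m + k)))) +
          ENNReal.ofReal (c₀⁻¹ * (Fintype.card ((↥(box 4 R) × Fin 4) × Fin 8) * 2328) * ε ^ (-(k / (m + k)))) +
          ENNReal.ofReal (12 * (Fintype.card ((↥(box 4 R) × Fin 4) × Fin 8) * C_B) * ε ^ (-(k / (m + k)))) :=
          add_le_add (add_le_add h4 le_rfl) le_rfl
      _ = _ := by
          rw [← ENNReal.ofReal_add (by positivity) (by positivity), ← ENNReal.ofReal_add (by positivity) (by positivity)]
          congr 1
          ring
  replace hlin := hlin.trans hbound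
  -- integrability of the local trace and conversion to the Bochner integral
  have htxr := stub_localTraceRegular L x m₀ ε hε
  have hglue : Continuous fun V : GaugeConfig 4 L SU3 =>
      ((fun e : Edge 4 L => if (∃ y ∈ box 4 R, e.1 = x + Torus.proj L y) then V e else U e) :
        GaugeConfig 4 L SU3) := by
    have h := (cellAverage_continuous_glue (L := L)
      (fun e : Edge 4 L => ∃ y ∈ box 4 R, e.1 = x + Torus.proj L y)).comp (Continuous.prodMk_right U)
    exact h
  have hcont : Continuous fun V : GaugeConfig 4 L SU3 => ∑ a : Fin 3, ∑ α : Fin 4,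
        (((spinorLift gammaFive * wilsonDirac (fundamentalRep (Fin 3))
            (fun e => if (∃ y ∈ box 4 R, e.1 = x + Torus.proj L y) then V e else U e) m₀ 1 -
          ((ε : ℂ) * Complex.I) • (1 : Matrix (QuarkIdx L) (QuarkIdx L) ℂ))⁻¹ :
            Matrix (QuarkIdx L) (QuarkIdx L) ℂ) (x, a, α) (x, a, α)).im := by
    have h := htxr.1.comp hglue
    exact h
  have hnn : 0 ≤ᵐ[Measure.pi fun _ : Edge 4 L => haarProbability SU3] fun V : GaugeConfig 4 L SU3 => ∑ a : Fin 3, ∑ α : Fin 4,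
        (((spinorLift gammaFive * wilsonDirac (fundamentalRep (Fin 3))
            (fun e => if (∃ y ∈ box 4 R, e.1 = x + Torus.proj L y) then V e else U e) m₀ 1 -
          ((ε : ℂ) * Complex.I) • (1 : Matrix (QuarkIdx L) (QuarkIdx L) ℂ))⁻¹ :
            Matrix (QuarkIdx L) (QuarkIdx L) ℂ) (x, a, α) (x, a, α)).im :=
    Filter.Eventually.of_forall fun V => (htxr.2 _).1
  rw [integral_eq_lintegral_of_nonneg_ae hnn hcont.aestronglyMeasurable]
  exact ENNReal.toReal_le_of_le_ofReal (by positivity) hlin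

end Summit.QuantumFields.QCD.Cruxes.WegnerEstimate.ResolventCell

end
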